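import Summits.QuantumFields.YangMills.Theorems.BalabanUVNodesN18CombStepRemainderTransport
import Summits.QuantumFields.YangMills.Theorems.BalabanUVNodesN18CombStepTransportedCombBC
import HarnessLib

/-!
# BalabanUVNodes ∕ node N18 = NE5 — closure-ledger item (iii), comb step M4c, file (6d):
# THE SHARP C¹ CANCELLED SUM AT ONE DIRECTION PAIR — EVERY SIDE TERM `O(η_j)` (the `2R∕ξ²` of (4d) replaced by the coarse-Lipschitz letter)

(Track A, DAG node N18 = `T4OutputRate.NE5`; cluster K4 «SpineRates», key item K3⁸ `SpineGivenEndpointR13SepCoPHV` (stmt-QuantumFields-27366);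
seat pub-ymgap-dag-n18-w3 g5, INTENT-6 = design step M4c of `COMB-STEP-DESIGN.md` ∕ `COMB-CHAIN-INDEX.md`.)

HONEST FRAMING.  Count-neutral kernel bookkeeping (`--supports stmt-QuantumFields-27366 --as helper`).  (4d) `norm_nabla_transported_comb_le` bounds
`‖∇^ξ_{Ū(U),ν}(W⟨·,μ⟩)(y)‖` by `ξ⁻¹·[main + 2·(R∕ξ + (η∕ξ)69ℓ²ta)]`, the `2R∕ξ` being the crude bound `‖Rem₁(c′)‖ + ‖Rem₁(c)‖` of the linearisation
remainders.  THIS file splits `W = M + Rem₁ + (η∕ξ)·BC` at both bonds (`Q₁Y = L·QY − (λ̄₊ − λ̄₋)`, `m(c₋) = λ̄₋` exactly) and uses (6d-pre)'s main block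
and base-change letters with (6c-β)'s ★★★ `norm_transport_potRem_sub_potRem_le` for the remainder:
`‖∇^ξ(W⟨·,μ⟩)(y)‖ ≤ ξ⁻¹·[(η∕ξ)L(69ℓta + L(ηa₁ + 2ta)) + 2(η∕ξ)69ℓ²ta + 4(17ℓt)(R∕ξ + (η∕ξ)3ℓ²ta) + (η∕ξ)3ℓ²ta + ξ⁻¹·800000ℓ²σ(η·L(ηa₁ + 2ta) + 2t)]`
— with `t = O(η_j²α)`, `ξ = Lη_j`, `σ = O(η_j)`: the `a₁` coefficient is `1` and EVERY other term carries a factor `η_j` (the `2R∕ξ²` C¹ floor of FILE 7 ∕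
NUMERICS-G5 is gone).  Extra hypotheses w.r.t. (4d): `0 < t` and the smallness `384ℓσ ≤ 1` (was `136ℓσ ≤ 1`).  The record-level letters and G⁗′ with this
input are NOT here (successor files, pattern (4e)/(5b)/(5c)).  Nothing of Bałaban's analysis is asserted beyond the cited tree theorems; NE5 NOT printed ∕
NOT proved; N18 NOT discharged; finite tori — nothing about the continuum ∕ OS ∕ mass gap; YM mass gap (Clay) NOT proved — R4 closes the conditional
finite-𝕋⁴ rung `BalabanLadder.UV` only.

0 `def`, 0 `sorry`.  References: T. Bałaban, CMP **98** (1985) 17–51 [Balaban1985Averaging] (Prop. 3 (122)–(126) p.36, (62)–(63) p.28, pp.24–25);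
CMP **109** (1987) 249–301 [Balaban1987RG1] ((0.4) p.253, (1.10)–(1.13) p.262, (2.17) p.269); Propagators I [Balaban1984PropagatorsI] ((1.11) p.19);
C. King, CMP **102** (1986) 649–677 [King1986] ((3.43)–(3.47) p.661).
-/

noncomputable section

open scoped BigOperators Matrix.Norms.L2Operator
open NormedSpace

namespace YMDAG.N18.TransportOfRecord

open Complex (I)
open Literature.MathematicalPhysics.QuantumFieldTheory.Balaban1983to89
open Literature.MathematicalPhysics.QuantumFieldTheory.Balaban1983to89.T4Continuum
open Literature.MathematicalPhysics.QuantumFieldTheory.Balaban1983to89.BlockAveraging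
open Literature.MathematicalPhysics.QuantumFieldTheory.Balaban1983to89.BlockAveragingEMLLinearised (linAvg combMean linAvg_eq_bondAvg_sub_grad_combMean)
open Literature.MathematicalPhysics.QuantumFieldTheory.Balaban1983to89.LatticeFieldCalculus (bondAvg)
open Literature.MathematicalPhysics.QuantumFieldTheory.Balaban1983to89.B12RegularSpaces111 (expI gaugeU adJ plaq plaq_eq nabla)
open Literature.MathematicalPhysics.QuantumFieldTheory.Balaban1983to89.MatrixLog (mlog)
open Literature.MathematicalPhysics.QuantumFieldTheory.Balaban1983to89.B7Prop1Explicit (U1 mem_U1)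
open Literature.MathematicalPhysics.QuantumFieldTheory.Balaban1983to89.B10Eq27TorusAxialLog (axialT axialT_self)
open Literature.MathematicalPhysics.QuantumFieldTheory.Balaban1983to89.T4TermwiseBCH (norm_units_conj_le)
open Literature.MathematicalPhysics.QuantumFieldTheory.Balaban1983to89.Node00.W1 (avgUnits)

variable {P : Params} {j : ℕ} {n : Type*} [Fintype n] [DecidableEq n] [Nonempty n]

omit [Fintype n] [DecidableEq n] [Nonempty n] in
/-- **`W = M + Rem₁ + (η∕ξ)·BC` at a coarse bond**: with `Q₁Y = L·QY − (λ̄_Y(d₊) − λ̄_Y(d₋))` (`linAvg_eq_bondAvg_sub_grad_combMean`),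
`Pot + s·(T − λ̄₋) = s·(L·Q) + (Pot − s·Q₁) + s·(T − λ̄₊)` for any `Pot, T` (here `T = U_A·m(d₊)·U_A⁻¹`). [cite: Balaban1985Averaging, (124)-(125) p.36] -/
theorem transported_comb_split (Y : PBond P j → Matrix n n ℂ) (d : PBond P (j + 1)) (Pot T : Matrix n n ℂ) (s : ℂ) :
    Pot + s • (T - combMean Y d.src) =
      s • (((P.L : ℕ) : ℂ) • bondAvg Y d) + (Pot - s • linAvg Y d) + s • (T - combMean Y d.tgt) := by
  rw [linAvg_eq_bondAvg_sub_grad_combMean]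
  simp only [smul_sub]
  abel

/-- ★★ **THE SHARP C¹ CANCELLED SUM AT ONE DIRECTION PAIR** `(y, ν, μ)` (`μ = ν` allowed; `j + 2 ≤ m + K`): hypotheses of (4d) `norm_nabla_transported_comb_le` plus
`0 < t` and `384ℓσ ≤ 1` (`σ = (2ηa + t + 2ηa·t) + t`, `ℓ = (d+2)L`).  With `W(c) = (iξ)⁻¹log(Ū(𝐔)(c)Ū(U)(c)⁻¹) + (η∕ξ)(Ū(U)(c)m(c₊)Ū(U)(c)⁻¹ − m(c₋))`,
`m(z) = λ̄_{Ad(axialT U (emb z))A′}(z)`, `R` = (4c)'s polynomial: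
`‖∇^ξ_{Ū(U),ν}(W⟨·,μ⟩)(y)‖ ≤ ξ⁻¹·[(η∕ξ)·L·(69ℓ·t·a + L·(η·a₁ + 2t·a)) + 2·(η∕ξ)·69ℓ²·t·a + (4(17ℓt)(R∕ξ + (η∕ξ)3ℓ²ta) + (η∕ξ)3ℓ²ta + ξ⁻¹·800000·ℓ²σ·(η·L(ηa₁ + 2ta) + 2t))]`.
[cite: Balaban1985Averaging, Prop. 3 (122)-(126) p.36, (62)-(63) p.28, pp.24-25; Balaban1984PropagatorsI, (1.11) p.19; Balaban1987RG1, (0.4) p.253, (1.10)-(1.13) p.262, (2.17) p.269;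
King1986, (3.43)-(3.47) p.661] -/
theorem norm_nabla_transported_comb_sharp_le (hj : j + 1 ≤ P.m + P.K) (hj2 : j + 2 ≤ P.m + P.K) (y : Site P (j + 1)) (μ ν : Fin P.d)
    {Uc U : GaugeField P j (Matrix n n ℂ)ˣ} {A : PBond P j → Matrix n n ℂ} {η ξ a a₁ α t : ℝ} (hη : 0 < η) (hξ : 0 < ξ) (ha0 : 0 ≤ a) (ha1 : 0 ≤ a₁)
    (hα : 0 ≤ α)
    (hf : ∀ b : PBond P j, (blockOf b.src = y ∨ blockOf b.src = y.shift μ ∨ blockOf b.src = y.shift ν ∨ blockOf b.src = (y.shift μ).shift ν) →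
      (blockOf b.tgt = y ∨ blockOf b.tgt = y.shift μ ∨ blockOf b.tgt = y.shift ν ∨ blockOf b.tgt = (y.shift μ).shift ν) → Uc b = expI η (A b) * U b)
    (hA : ∀ b : PBond P j, (blockOf b.src = y ∨ blockOf b.src = y.shift μ ∨ blockOf b.src = y.shift ν ∨ blockOf b.src = (y.shift μ).shift ν) →
      (blockOf b.tgt = y ∨ blockOf b.tgt = y.shift μ ∨ blockOf b.tgt = y.shift ν ∨ blockOf b.tgt = (y.shift μ).shift ν) → ‖A b‖ ≤ a)
    (hηa : η * a ≤ 1 / 2)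
    (hU1 : ∀ b : PBond P j, (blockOf b.src = y ∨ blockOf b.src = y.shift μ ∨ blockOf b.src = y.shift ν ∨ blockOf b.src = (y.shift μ).shift ν) →
      (blockOf b.tgt = y ∨ blockOf b.tgt = y.shift μ ∨ blockOf b.tgt = y.shift ν ∨ blockOf b.tgt = (y.shift μ).shift ν) → U b ∈ U1 (Matrix n n ℂ))
    (hplaq : ∀ p : Plaq P j, (blockOf p.src = y ∨ blockOf p.src = y.shift μ ∨ blockOf p.src = y.shift ν ∨ blockOf p.src = (y.shift μ).shift ν) →
      (blockOf (p.src.shift p.μ) = y ∨ blockOf (p.src.shift p.μ) = y.shift μ ∨ blockOf (p.src.shift p.μ) = y.shift ν ∨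
        blockOf (p.src.shift p.μ) = (y.shift μ).shift ν) →
      (blockOf (p.src.shift p.ν) = y ∨ blockOf (p.src.shift p.ν) = y.shift μ ∨ blockOf (p.src.shift p.ν) = y.shift ν ∨
        blockOf (p.src.shift p.ν) = (y.shift μ).shift ν) →
      (blockOf ((p.src.shift p.μ).shift p.ν) = y ∨ blockOf ((p.src.shift p.μ).shift p.ν) = y.shift μ ∨
        blockOf ((p.src.shift p.μ).shift p.ν) = y.shift ν ∨ blockOf ((p.src.shift p.μ).shift p.ν) = (y.shift μ).shift ν) →
      ‖((plaq U p : (Matrix n n ℂ)ˣ) : Matrix n n ℂ) - 1‖ ≤ α)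
    (hA1 : ∀ (z : Site P j) (κ : Fin P.d),
      (blockOf z = y ∨ blockOf z = y.shift μ ∨ blockOf z = y.shift ν ∨ blockOf z = (y.shift μ).shift ν) →
      (blockOf (z.shift ν) = y ∨ blockOf (z.shift ν) = y.shift μ ∨ blockOf (z.shift ν) = y.shift ν ∨ blockOf (z.shift ν) = (y.shift μ).shift ν) →
      (blockOf (z.shift κ) = y ∨ blockOf (z.shift κ) = y.shift μ ∨ blockOf (z.shift κ) = y.shift ν ∨ blockOf (z.shift κ) = (y.shift μ).shift ν) →
      (blockOf ((z.shift ν).shift κ) = y ∨ blockOf ((z.shift ν).shift κ) = y.shift μ ∨ blockOf ((z.shift ν).shift κ) = y.shift ν ∨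
        blockOf ((z.shift ν).shift κ) = (y.shift μ).shift ν) →
      ‖nabla η U ν (fun w => A ⟨w, κ⟩) z‖ ≤ a₁)
    (hRt : ((((P.d + 4) * P.L : ℕ) : ℝ) / 2) * α ≤ t)
    (ht : 0 < t) (hℓ : 384 * (((P.d + 2) * P.L : ℕ) : ℝ) * ((2 * (η * a) + t + 2 * (η * a) * t) + t) ≤ 1)
    (hUAν : avgUnits U ⟨y, ν⟩ ∈ U1 (Matrix n n ℂ)) :
    ‖nabla ξ (avgUnits U) ν
        (fun w => (I * (ξ : ℂ))⁻¹ • mlog (((avgUnits Uc ⟨w, μ⟩ : (Matrix n n ℂ)ˣ) : Matrix n n ℂ) * (((avgUnits U ⟨w, μ⟩)⁻¹ : (Matrix n n ℂ)ˣ) : Matrix n n ℂ)) +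
          ((η / ξ : ℝ) : ℂ) • (((avgUnits U ⟨w, μ⟩ : (Matrix n n ℂ)ˣ) : Matrix n n ℂ) * combMean (adJ (axialT U (emb (w.shift μ))) A) (w.shift μ) *
            (((avgUnits U ⟨w, μ⟩)⁻¹ : (Matrix n n ℂ)ˣ) : Matrix n n ℂ) - combMean (adJ (axialT U (emb w)) A) w)) y‖ ≤
      ξ⁻¹ * (η / ξ * (P.L : ℝ) * (69 * (((P.d + 2) * P.L : ℕ) : ℝ) * t * a + (P.L : ℝ) * (η * a₁ + 2 * t * a)) +
        2 * (η / ξ * (69 * (((P.d + 2) * P.L : ℕ) : ℝ) ^ 2 * t * a)) +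
        (4 * (17 * (((P.d + 2) * P.L : ℕ) : ℝ) * t) *
            ((4 * (34 * (((P.d + 2) * P.L : ℕ) : ℝ) * ((2 * (η * a) + t + 2 * (η * a) * t) + t)) ^ 2 +
              578 * (((P.d + 2) * P.L : ℕ) : ℝ) ^ 2 * ((2 * (η * a) + t + 2 * (η * a) * t) + t) * t +
              660 * (((P.d + 2) * P.L : ℕ) : ℝ) ^ 2 * ((2 * (η * a) + t + 2 * (η * a) * t) ^ 2 + t ^ 2) +
              3 * (((P.d + 2) * P.L : ℕ) : ℝ) * (2 * (η * a) * t) + 3 * (((P.d + 2) * P.L : ℕ) : ℝ) * (η * a) ^ 2) / ξ +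
              η / ξ * (3 * (((P.d + 2) * P.L : ℕ) : ℝ) ^ 2 * t * a)) +
          η / ξ * (3 * (((P.d + 2) * P.L : ℕ) : ℝ) ^ 2 * t * a) +
          ξ⁻¹ * (800000 * (((P.d + 2) * P.L : ℕ) : ℝ) ^ 2 * ((2 * (η * a) + t + 2 * (η * a) * t) + t) * (η * ((P.L : ℝ) * (η * a₁ + 2 * t * a)) + 2 * t)))) := by
  classical
  have ht0 : 0 ≤ t := ht.le
  set ℓ : ℝ := (((P.d + 2) * P.L : ℕ) : ℝ) with hℓdef
  have hℓ0 : 0 ≤ ℓ := Nat.cast_nonneg _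
  have hσ0 : 0 ≤ ((2 * (η * a) + t + 2 * (η * a) * t) + t) := by positivity
  have hℓ136 : 136 * ℓ * ((2 * (η * a) + t + 2 * (η * a) * t) + t) ≤ 1 := by nlinarith only [hℓ, hℓ0, hσ0]
  have hℓt : 136 * ℓ * t ≤ 1 := by
    nlinarith only [hℓ136, hℓ0, ht0, mul_nonneg hη.le ha0, mul_nonneg (mul_nonneg hℓ0 (mul_nonneg hη.le ha0)) ht0]
  have h48t : 48 * ℓ * t ≤ 1 := by nlinarith only [hℓt, hℓ0, ht0]
  have hRt2 : ((((P.d + 2) * P.L : ℕ) : ℝ) / 2) * α ≤ t := by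
    refine le_trans (mul_le_mul_of_nonneg_right ?_ hα) hRt
    gcongr; omega
  have hνμ : (y.shift ν).shift μ = (y.shift μ).shift ν := Site.shift_comm _ _ _
  have incC : ∀ x : Site P j, (blockOf x = y ∨ blockOf x = (y.shift μ)) → (blockOf x = y ∨ blockOf x = y.shift μ ∨ blockOf x = y.shift ν ∨ blockOf x = (y.shift μ).shift ν) := fun x h => by
    rcases h with h | h
    · exact Or.inl h
    · exact Or.inr (Or.inl h)
  have incC' : ∀ x : Site P j, (blockOf x = (y.shift ν) ∨ blockOf x = ((y.shift ν).shift μ)) → (blockOf x = y ∨ blockOf x = y.shift μ ∨ blockOf x = y.shift ν ∨ blockOf x = (y.shift μ).shift ν) := fun x h => by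
    rcases h with h | h
    · exact Or.inr (Or.inr (Or.inl h))
    · refine Or.inr (Or.inr (Or.inr ?_)); rw [← hνμ]; exact h
  have plaqOf : ∀ (d : PBond P (j + 1)) (inc : ∀ x : Site P j, (blockOf x = d.src ∨ blockOf x = d.tgt) → (blockOf x = y ∨ blockOf x = y.shift μ ∨ blockOf x = y.shift ν ∨ blockOf x = (y.shift μ).shift ν)),
      ∀ p : Plaq P j, (blockOf p.src = d.src ∨ blockOf p.src = d.tgt) →
      (blockOf (p.src.shift p.μ) = d.src ∨ blockOf (p.src.shift p.μ) = d.tgt) →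
      (blockOf (p.src.shift p.ν) = d.src ∨ blockOf (p.src.shift p.ν) = d.tgt) →
      (blockOf ((p.src.shift p.μ).shift p.ν) = d.src ∨ blockOf ((p.src.shift p.μ).shift p.ν) = d.tgt) →
      ‖((plaq U p : (Matrix n n ℂ)ˣ) : Matrix n n ℂ) - 1‖ ≤ α := fun d inc p h1 h2 h3 h4 =>
    hplaq p (inc _ h1) (inc _ h2) (inc _ h3) (inc _ h4)
  -- the three letters: main block, base changes at `c` and `c′`, transported remainder
  have hmain := norm_transported_main_sub_main_le hj hj2 y μ ν (U := U) (A := A) hη hξ ha0 ha1 hα hA hU1 hplaq hA1 hRt hℓt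
  have hBC := norm_transported_comb_sub_combMean_le hj hj2 (⟨y, μ⟩ : PBond P (j + 1)) (U := U) (A := A) ha0 hα
    (fun b h1 h2 => hA b (incC _ h1) (incC _ h2)) (fun b h1 h2 => hU1 b (incC _ h1) (incC _ h2)) (plaqOf ⟨y, μ⟩ incC) hRt2 h48t
  have hBC' := norm_transported_comb_sub_combMean_le hj hj2 (⟨y.shift ν, μ⟩ : PBond P (j + 1)) (U := U) (A := A) ha0 hα
    (fun b h1 h2 => hA b (incC' _ h1) (incC' _ h2)) (fun b h1 h2 => hU1 b (incC' _ h1) (incC' _ h2)) (plaqOf ⟨y.shift ν, μ⟩ incC') hRt2 h48t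
  dsimp only [PBond.tgt] at hBC hBC'
  have hrem := norm_transport_potRem_sub_potRem_le hj hj2 y μ ν (Uc := Uc) (U := U) (A := A) hη hξ ha0 ha1 hα ht hf hA hηa hU1 hplaq hA1 hRt hℓ
  -- the covariant difference quotient
  unfold nabla
  dsimp only
  rw [norm_smul, norm_inv, Complex.norm_real, Real.norm_of_nonneg hξ.le]
  refine mul_le_mul_of_nonneg_left ?_ (inv_nonneg.mpr hξ.le)
  -- split `W = M + Rem₁ + (η∕ξ)·BC` at both bonds
  rw [transported_comb_split (adJ (axialT U (emb y)) A) ⟨y, μ⟩, transported_comb_split (adJ (axialT U (emb (y.shift ν))) A) ⟨y.shift ν, μ⟩]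
  dsimp only [PBond.tgt]
  -- abstract the letters
  generalize hgdef : ((avgUnits U ⟨y, ν⟩ : (Matrix n n ℂ)ˣ) : Matrix n n ℂ) = g at hmain hrem ⊢
  generalize hgidef : (((avgUnits U ⟨y, ν⟩)⁻¹ : (Matrix n n ℂ)ˣ) : Matrix n n ℂ) = gi at hmain hrem ⊢
  generalize hMdef : ((η / ξ : ℝ) : ℂ) • (((P.L : ℕ) : ℂ) • bondAvg (adJ (axialT U (emb y)) A) ⟨y, μ⟩) = M at hmain ⊢
  generalize hM'def : ((η / ξ : ℝ) : ℂ) • (((P.L : ℕ) : ℂ) • bondAvg (adJ (axialT U (emb (y.shift ν))) A) ⟨y.shift ν, μ⟩) = M' at hmain ⊢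
  generalize hRdef : ((I * (ξ : ℂ))⁻¹ • mlog (((avgUnits Uc ⟨y, μ⟩ : (Matrix n n ℂ)ˣ) : Matrix n n ℂ) * (((avgUnits U ⟨y, μ⟩)⁻¹ : (Matrix n n ℂ)ˣ) : Matrix n n ℂ)) -
      ((η / ξ : ℝ) : ℂ) • linAvg (adJ (axialT U (emb y)) A) ⟨y, μ⟩) = Rm at hrem ⊢
  generalize hR'def : ((I * (ξ : ℂ))⁻¹ • mlog (((avgUnits Uc ⟨y.shift ν, μ⟩ : (Matrix n n ℂ)ˣ) : Matrix n n ℂ) * (((avgUnits U ⟨y.shift ν, μ⟩)⁻¹ : (Matrix n n ℂ)ˣ) : Matrix n n ℂ)) -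
      ((η / ξ : ℝ) : ℂ) • linAvg (adJ (axialT U (emb (y.shift ν))) A) ⟨y.shift ν, μ⟩) = Rm' at hrem ⊢
  generalize hBdef : (((avgUnits U ⟨y, μ⟩ : (Matrix n n ℂ)ˣ) : Matrix n n ℂ) * combMean (adJ (axialT U (emb (y.shift μ))) A) (y.shift μ) *
      (((avgUnits U ⟨y, μ⟩)⁻¹ : (Matrix n n ℂ)ˣ) : Matrix n n ℂ) - combMean (adJ (axialT U (emb y)) A) (y.shift μ)) = B at hBC ⊢
  generalize hB'def : (((avgUnits U ⟨y.shift ν, μ⟩ : (Matrix n n ℂ)ˣ) : Matrix n n ℂ) * combMean (adJ (axialT U (emb ((y.shift ν).shift μ))) A) ((y.shift ν).shift μ) *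
      (((avgUnits U ⟨y.shift ν, μ⟩)⁻¹ : (Matrix n n ℂ)ˣ) : Matrix n n ℂ) - combMean (adJ (axialT U (emb (y.shift ν))) A) ((y.shift ν).shift μ)) = B' at hBC' ⊢
  have hsplit : g * (M' + Rm' + ((η / ξ : ℝ) : ℂ) • B') * gi - (M + Rm + ((η / ξ : ℝ) : ℂ) • B) =
      (g * M' * gi - M) + (g * Rm' * gi - Rm) + (g * (((η / ξ : ℝ) : ℂ) • B') * gi - ((η / ξ : ℝ) : ℂ) • B) := by noncomm_ring
  rw [hsplit]
  have hηξ : 0 ≤ η / ξ := div_nonneg hη.le hξ.le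
  have hBCt : ‖g * (((η / ξ : ℝ) : ℂ) • B') * gi - ((η / ξ : ℝ) : ℂ) • B‖ ≤ 2 * (η / ξ * (69 * ℓ ^ 2 * t * a)) := by
    refine (norm_sub_le _ _).trans ?_
    have h1 : ‖g * (((η / ξ : ℝ) : ℂ) • B') * gi‖ ≤ ‖((η / ξ : ℝ) : ℂ) • B'‖ := by rw [← hgdef, ← hgidef]; exact norm_units_conj_le hUAν _
    have h2 : ‖((η / ξ : ℝ) : ℂ) • B'‖ ≤ η / ξ * (69 * ℓ ^ 2 * t * a) := by
      rw [norm_smul, Complex.norm_real, Real.norm_of_nonneg hηξ]; exact mul_le_mul_of_nonneg_left hBC' hηξ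
    have h3 : ‖((η / ξ : ℝ) : ℂ) • B‖ ≤ η / ξ * (69 * ℓ ^ 2 * t * a) := by
      rw [norm_smul, Complex.norm_real, Real.norm_of_nonneg hηξ]; exact mul_le_mul_of_nonneg_left hBC hηξ
    linarith
  refine (norm_add₃_le).trans ?_
  rw [hℓdef] at hBCt
  linarith [hmain, hrem, hBCt]

end YMDAG.N18.TransportOfRecord

end
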